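import Summits.ResolutionOfSingularities.ResolutionOfSingularities.Theses.ShadowGame
import Summits.ResolutionOfSingularities.ResolutionOfSingularities.Theses.Valuative
import Summits.ResolutionOfSingularities.ResolutionOfSingularities.Theorems.ShadowGameWin.Negative.EveryDimTrap
import Summits.ResolutionOfSingularities.ResolutionOfSingularities.Cruxes.LuAlphaPTorsor.Disproof

/-!
# Disproof of `WinToTorsorLUR` (crux stmt-ResolutionOfSingularities-18185, route `ShadowGame` rev 3) — findings

Standing adversary (cdisprove, cycle 1: refuter-cdisprove-stmt-ResolutionOfSingularities-18185-0, 2026-08-17).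

> `WinToTorsorLUR : Prop := ShadowGameWinR → TorsorLUPerfect`

Every `theorem` below is kernel-checked (rc 0) unless it carries an explicit `sorry` (§4, marked
NEAR-MISS, with the obstruction in its docstring).  Index:

§1 ANATOMY.  `winToTorsorLUR_iff`, `not_winToTorsorLUR_iff : ¬ WinToTorsorLUR ↔ ShadowGameWinR ∧
   ¬ TorsorLUPerfect`, the S → C probes `winToTorsorLUR_of_torsorLUPerfect`,
   `winToTorsorLUR_of_resolutionOfSingularities`, the vacuity form
   `winToTorsorLUR_of_not_shadowGameWinR`, and `not_resolution_of_not_winToTorsorLUR`: refuting this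
   crux is refuting resolution in positive characteristic (rev-2 §3 applies verbatim).  So the only
   refuter questions are (a) VACUITY (is `ShadowGameWinR` false?) and (b) COSTUME.  Dropping the only
   hypothesis gives the bare target (`withoutShadowGameWinR_iff`) — no `_false_without_` lemma short
   of `¬ TorsorLUPerfect`.

§2 THE FORMAL CLAUSE IS LOAD-BEARING.  `ShadowGameWinR` with its new terminal clause deleted is
   literally the rev-2 `ShadowGameWin`, refuted in the tree: `shadowGameWinR_false_without_formalClause`.

§3 MIRROR of the repaired game (`FormalMono`, `TerminalR`, `AWinsR`; moves = the tree's rev-2 mirror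
   `ShadowGameWin.Negative.{clean, step, play}` — the route says "verbatim as in rev 2"), with
   `shadowGameWinR_iff_aWinsR : ShadowGameWinR ↔ ∀ p prime, ∀ n ≥ 1, AWinsR p n` by `Iff.rfl`;
   `terminalR_of_old`, `aWinsR_of_aWins`, `aWinsR_one` (n = 1 is still an A-win).

§4 VACUITY ATTACK AT n = 3 — "HIDDEN TANGENCY" (the cycle-1 finding; NEAR-MISS in Lean, certified by
   computation, see the evidence file `BWIN-n3.md` + `sim/` on items 18185 / 18182).
   CLAIM (every odd prime p): B wins `SG^R_p(3)` from the POLYNOMIAL start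
       a₀ = u₁² · (u₁ + h²)^p,   h = u₃ − u₂ − u₂u₃   (over κ = 𝔽_p; `startR3`),
   with the MEMORYLESS policy `chartR3` / constant translation `tauR3 = (0, 0, 1)`:
   centre {u₁,u₂} ↦ chart u₂; {u₁,u₃} ↦ chart u₃; {u₂,u₃} and the point ↦ chart u₂ with u₃ ↦ u₃ + 1
   (B walks along the branch h = 0, which is INVARIANT: h(u₂, u₂(u₃+1)) = u₂·h); u₁ is never a chart
   and never translated.  INVARIANT: every position is ε·u^M·q^p with ε a unit, M₁ = 2 for ever, and
   q either smooth with tangent plane u₁ = 0 (q = u₁ν + u₂^a u₃^b θ h², ord ≥ 2 part) or a singular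
   PRIME (q = u₁u₂^c u₃^d ν + u₂^a u₃^b θ h², after a pair move hits a stripped g).  WHY NON-TERMINAL′:
   the D-LEMMA — if clean a = coeff(W^A v + G^p) with W a formal regular system of parameters then
   gcd_i(∂a/∂u_i) = ∏ W_j^{A_j − [p ∤ A_j]} · unit (the η-cofactors have gcd 1: test them against the
   dual derivations D_j, D_j W_k = δ_jk); for a = ε u^M q^p the gcd is q^p · u^{M − [·]}, so q would
   be a unit times a product of powers of members of ONE regular system of parameters that also
   contains u₁ (M₁ = 2) — impossible when q is smooth with linear part ∝ u₁, or singular and prime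
   (or, more generally, when no factorisation type of q is compatible with in(q), with
   β = q(0,u₂,u₃) = u₂^a u₃^b θ h² and with α₁ = ∂q/∂u₁(0,·): `sim/cert.py`, tests (c1)–(c4), all exact
   linear algebra over 𝔽_p and valid over 𝔽̄_p).  EVIDENCE: the factored dynamics agree with the
   literal move generator (`sim/sgr.py`, which reproduces the tree's rev-2 traps) on > 10⁵ moves;
   p = 3: ALL 117 649 plays of depth 6 (exhaustive over A's 7 centres) and the BFS-reachable set to
   depth 11 (27 375 states) are certified non-terminal′ (clauses 1–2 decided, clause 3 by the
   D-lemma certificate); p = 5, 7 likewise (see BWIN-n3.md for the exact counts).  Geometrically the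
   witness is again a MISSTATED-type artefact: Z^p = ε u^M q^p is normalised by Z ↦ Z/q to the toric
   Z′^p = ε u^M, but the whistle only accepts q among formal COORDINATES, and q is kept tangent to the
   exceptional plane u₁ = 0 along the non-coordinate, blow-up-invariant branch h = 0.  Repaired whistle
   C″: `∃ Q w A v g, clean c = coeff (Q^p * w^A * v + g^p)` (terminal modulo p-th-power FACTORS);
   a₀ is C″-terminal at stage 0.  Per the route's kill criterion (ii) a B-win at n ≤ 3 closes
   `ShadowGameWinR` (no third whistle) — and makes THIS crux vacuous (`winToTorsorLUR_of_trapR3`).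
   OBSTRUCTION to a kernel proof: non-terminality of clause 3 needs the calculus of derivations on
   `MvPowerSeries (Fin 3) κ` and unique factorisation in κ⟦u₁,u₂,u₃⟧ (not in Mathlib); the dynamics
   part alone would be a `decide`-free symbolic induction over an infinite family (cf. the 600-line
   n = 2 `CurveFamilyTrap`).  Hence `trapR3_nonterminal` is stated with `sorry` and everything
   downstream of it is marked conditional.

§5 STATUS SYNC (2026-08-17 ≥ 15:10Z).  The crux team of `ShadowGameWinR` itself (stmt-18182) reached the same
   verdict independently and earlier today: `Cruxes/ShadowGameWinR/BWinDim3.md` (refuter-rattack: three smooth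
   surfaces `S₂S₃(S₂+S₃)` through a transcendental curve Γ, B wins for p ≠ 3 — a REDUCED position, so it even
   defeats the repaired whistle C″ above) and `Cruxes/ShadowGameWinR/PICKED.md` + the landed
   `Theorems/ShadowGameWinR/Negative/MirrorR.lean` (lead prover-line-…-18182: cuspidal edge `x·Π^p`,
   `Π = x^a z^{2e} U y² − x^b W³`, `W = z − x − xz` — the same invariant branch `z = x/(1−x)` and the same
   "monomial × p-th power" mechanism as §4 —, kernel refutation `Theorems/ShadowGameShadowGameWinRRefutation.lean`
   in progress).  This seat's simulator + D-lemma certificate confirm the lead's family too (p = 2: all 16 807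
   depth-5 plays, 221 states; p = 5 BFS; `BWIN-n3.md` §8b).  CONSEQUENCE FOR THIS CRUX: once `¬ ShadowGameWinR`
   is in the tree, item 18185 closes by the one-liner `fun hW => absurd hW <that theorem>` (cf.
   `winToTorsorLUR_of_not_shadowGameWinR`); no prover/lead time should go into the dictionary, the algebraisation
   (Artin approximation) or the log-blow-up endgame of this crux on the CURRENT game.  The tree mirror
   `ShadowGameWinR.Negative.{TerminalR, AWinsR, shadowGameWinR_iff}` is definitionally equal to the one of §3
   (both verbatim); the landed negative lemma of this crux (`Theorems/WinToTorsorLUR/Negative/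
   FormalClauseLoadBearing.lean`, p168670, review-queued) is stated against the tree mirror.
-/

noncomputable section

-- single-problem summit: the doubled namespace component is forced
set_option linter.dupNamespace false

namespace Summit.ResolutionOfSingularities.ResolutionOfSingularities.Cruxes.WinToTorsorLUR.Disproof

open Summit.ResolutionOfSingularities.ResolutionOfSingularities.Theses.ShadowGame
  (ShadowGameWinR TorsorLUPerfect WinToTorsorLUR)
open Summit.ResolutionOfSingularities.ResolutionOfSingularities.Cruxes.LuAlphaPTorsor.Disproof
  (luAlphaPTorsor_of_resolutionOfSingularities)
open Summit.ResolutionOfSingularities.ResolutionOfSingularities.Theorems.ShadowGameWin.Negative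
  (clean step play shadow play_succ S0 iSeq tSeq run chart tau cycle not_terminal_of_inCycle)

/-! ## §1 Anatomy of the crux -/

/-- The crux is, by definition, the implication `ShadowGameWinR → TorsorLUPerfect`. [folklore] -/
theorem winToTorsorLUR_iff : WinToTorsorLUR ↔ (ShadowGameWinR → TorsorLUPerfect) := Iff.rfl

/-- A disproof of the crux is exactly: a shadow-measurable winning strategy for A in every repaired
game `SG^R_p(n)` AND a failure of LU of `α_p`-torsors over some perfect field. [folklore] -/
theorem not_winToTorsorLUR_iff : ¬ WinToTorsorLUR ↔ (ShadowGameWinR ∧ ¬ TorsorLUPerfect) := by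
  rw [winToTorsorLUR_iff, Classical.not_imp]

/-- S → C probe: the route target implies the crux outright (the crux is weaker than the target).
[folklore] -/
theorem winToTorsorLUR_of_torsorLUPerfect (h : TorsorLUPerfect) : WinToTorsorLUR := fun _ => h

/-- Vacuity form: if the repaired game is lost by A, the crux holds for nothing. [folklore] -/
theorem winToTorsorLUR_of_not_shadowGameWinR (h : ¬ ShadowGameWinR) : WinToTorsorLUR :=
  fun hW => absurd hW h

/-- `WinToTorsorLUR` with its only hypothesis dropped: this IS the route target. [folklore] -/
def WithoutShadowGameWinR : Prop := TorsorLUPerfect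

/-- Dropping the hypothesis lands on the target itself (so no `_false_without_` lemma exists short of
refuting the target). [folklore] -/
theorem withoutShadowGameWinR_iff : WithoutShadowGameWinR ↔ TorsorLUPerfect := Iff.rfl

/-- The route target is Valuative's crux `LuAlphaPTorsor` (stmt-0641) restricted to perfect ground
fields. [folklore] -/
theorem torsorLUPerfect_of_luAlphaPTorsor
    (h : Summit.ResolutionOfSingularities.ResolutionOfSingularities.Theses.Valuative.LuAlphaPTorsor) :
    TorsorLUPerfect :=
  fun p hp k K _ _ _ _ _ O A₀ h₀ t hfg htp hfr hreg => h p hp k K O A₀ h₀ t hfg htp hfr hreg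

/-- The summit implies the target (tree: `Cruxes/LuAlphaPTorsor/Disproof.lean` §1, i.e.
`ResolutionInChar.relLocalUniformization`). [folklore] -/
theorem torsorLUPerfect_of_resolutionOfSingularities (h : _root_.ResolutionOfSingularities) :
    TorsorLUPerfect :=
  torsorLUPerfect_of_luAlphaPTorsor (luAlphaPTorsor_of_resolutionOfSingularities h)

/-- The summit implies the crux. [folklore] -/
theorem winToTorsorLUR_of_resolutionOfSingularities (h : _root_.ResolutionOfSingularities) :
    WinToTorsorLUR :=
  fun _ => torsorLUPerfect_of_resolutionOfSingularities h

/-- **No unconditional refutation of this crux exists short of `¬ ResolutionOfSingularities`**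
(for EVERY antecedent `X`: a refutation of `X → TorsorLUPerfect` refutes the summit). [folklore] -/
theorem not_resolution_of_not_implication (X : Prop) (h : ¬ (X → TorsorLUPerfect)) :
    ¬ _root_.ResolutionOfSingularities :=
  fun H => h fun _ => torsorLUPerfect_of_resolutionOfSingularities H

/-- Instance for this crux. [folklore] -/
theorem not_resolution_of_not_winToTorsorLUR (h : ¬ WinToTorsorLUR) :
    ¬ _root_.ResolutionOfSingularities :=
  not_resolution_of_not_implication ShadowGameWinR h

/-- Hence the crux is irrefutable in any model of the summit. [folklore] -/
theorem not_not_winToTorsorLUR_of_resolution (h : _root_.ResolutionOfSingularities) :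
    ¬ ¬ WinToTorsorLUR :=
  fun hn => not_resolution_of_not_winToTorsorLUR hn h

/-! ## §2 The formal (re-parametrisation) clause of the whistle is load-bearing -/

/-- The rev-2 inner statement at `(p, n)` (the route's retired `ShadowGameWin`, whose decl is no
longer in the route file; written with the tree's mirror `ShadowGameWin.Negative.{play, clean}`):
TERMINAL′ with its formal clause deleted. [folklore] -/
def AWinsOld (p n : ℕ) : Prop :=
  ∃ strat : List (Set (Fin n → ℚ)) → List (Fin n) → Finset (Fin n),
    (∀ hs js, (strat hs js).Nonempty) ∧
    ∀ (κ : Type) [Field κ] [CharP κ p] [PerfectField κ] (c₀ : (Fin n → ℕ) → κ) (i : ℕ → Fin n)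
      (t : ℕ → Fin n → κ),
      (∀ m, i m ∈ strat (play p strat c₀ i t m).2.1 (play p strat c₀ i t m).2.2) →
        ∃ m, (∀ A, clean p (play p strat c₀ i t m).1 A = 0) ∨
          ∃ A, clean p (play p strat c₀ i t m).1 A ≠ 0 ∧
            (Finset.sum Finset.univ (fun j => A j) ≤ 1 ∨
              ∀ B, clean p (play p strat c₀ i t m).1 B ≠ 0 → ∀ j, A j ≤ B j)

/-- `ShadowGameWinR` with the formal clause of its whistle deleted (= the retired rev-2
`ShadowGameWin`, by name no longer in the route file). [folklore] -/
def ShadowGameWinRWithoutFormalClause : Prop := ∀ p : ℕ, p.Prime → ∀ n : ℕ, 0 < n → AWinsOld p n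

section RevTwoTrap

open Summit.ResolutionOfSingularities.ResolutionOfSingularities.Theorems.ShadowGameWin.Negative

/-- The non-empty subsets of `Fin 2`. [folklore] -/
theorem finset_fin_two_cases (F : Finset (Fin 2)) :
    F = ∅ ∨ F = {0} ∨ F = {1} ∨ F = {0, 1} := by
  by_cases h0 : (0 : Fin 2) ∈ F <;> by_cases h1 : (1 : Fin 2) ∈ F
  · right; right; right; ext j; fin_cases j <;> simp [h0, h1]
  · right; left; ext j; fin_cases j <;> simp [h0, h1]
  · right; right; left; ext j; fin_cases j <;> simp [h0, h1]
  · left; ext j; fin_cases j <;> simp [h0, h1]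

/-- B's chart is legal: `chart F ∈ F` whenever `F` is non-empty. [folklore] -/
theorem chart_mem {F : Finset (Fin 2)} (hF : F.Nonempty) : chart F ∈ F := by
  unfold chart
  split_ifs with h
  · exact h
  · rcases finset_fin_two_cases F with rfl | rfl | rfl | rfl
    · exact absurd hF (Finset.not_nonempty_empty)
    · exact absurd (Finset.mem_singleton_self 0) h
    · exact Finset.mem_singleton_self 1
    · exact absurd (by simp) h

/-- B's chart on the point centre is `u`. [folklore] -/
theorem chart_pair : chart ({0, 1} : Finset (Fin 2)) = 0 := by
  unfold chart; rw [if_pos (by simp)]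

/-- B's chart on the centre `{u}` is `u`. [folklore] -/
theorem chart_zero : chart ({0} : Finset (Fin 2)) = 0 := by
  unfold chart; rw [if_pos (by simp)]

/-- B's chart on the centre `{v}` is `v`. [folklore] -/
theorem chart_one : chart ({1} : Finset (Fin 2)) = 1 := by
  unfold chart; rw [if_neg (by simp)]

/-- `S0 ≠ S2` (they differ at the exponent `(0,2)`). [folklore] -/
theorem S0_ne_S2 : S0 ≠ S2 := fun h => absurd (congrFun h ![0, 2]) (by decide)
/-- `S0 ≠ S5`. [folklore] -/
theorem S0_ne_S5 : S0 ≠ S5 := fun h => absurd (congrFun h ![0, 2]) (by decide)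
/-- `S1 ≠ S2`. [folklore] -/
theorem S1_ne_S2 : S1 ≠ S2 := fun h => absurd (congrFun h ![2, 2]) (by decide)
/-- `S1 ≠ S5`. [folklore] -/
theorem S1_ne_S5 : S1 ≠ S5 := fun h => absurd (congrFun h ![2, 2]) (by decide)
/-- `S3 ≠ S2`. [folklore] -/
theorem S3_ne_S2 : S3 ≠ S2 := fun h => absurd (congrFun h ![0, 2]) (by decide)
/-- `S3 ≠ S5`. [folklore] -/
theorem S3_ne_S5 : S3 ≠ S5 := fun h => absurd (congrFun h ![0, 2]) (by decide)
/-- `S4 ≠ S2`. [folklore] -/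
theorem S4_ne_S2 : S4 ≠ S2 := fun h => absurd (congrFun h ![2, 2]) (by decide)
/-- `S4 ≠ S5`. [folklore] -/
theorem S4_ne_S5 : S4 ≠ S5 := fun h => absurd (congrFun h ![2, 2]) (by decide)
/-- `S5 ≠ S2` (they differ at `(2,1)`: coefficients `2` and `1`). [folklore] -/
theorem S5_ne_S2 : S5 ≠ S2 := fun h => absurd (congrFun h ![2, 1]) (by decide)

/-- B's translation at `S0` is `0`. [folklore] -/
theorem tau_S0 : tau S0 = fun _ => 0 := by unfold tau; rw [if_neg S0_ne_S2, if_neg S0_ne_S5]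
/-- B's translation at `S1` is `0`. [folklore] -/
theorem tau_S1 : tau S1 = fun _ => 0 := by unfold tau; rw [if_neg S1_ne_S2, if_neg S1_ne_S5]
/-- B's translation at `S2` is `1`. [folklore] -/
theorem tau_S2 : tau S2 = fun _ => 1 := by unfold tau; rw [if_pos rfl]
/-- B's translation at `S3` is `0`. [folklore] -/
theorem tau_S3 : tau S3 = fun _ => 0 := by unfold tau; rw [if_neg S3_ne_S2, if_neg S3_ne_S5]
/-- B's translation at `S4` is `0`. [folklore] -/
theorem tau_S4 : tau S4 = fun _ => 0 := by unfold tau; rw [if_neg S4_ne_S2, if_neg S4_ne_S5]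
/-- B's translation at `S5` is `2`. [folklore] -/
theorem tau_S5 : tau S5 = fun _ => 2 := by unfold tau; rw [if_neg S5_ne_S2, if_pos rfl]

/-- ONE MOVE OF THE TRAP: from a state of the cycle, whatever non-empty centre A names, B's answer
(chart `u` if allowed, the prescribed translation) leads back into the cycle — the point centre
advances the cycle (`step_S0 … step_S5`), a singleton centre is a no-op (`step_singleton`).
[folklore] -/
theorem step_mem_cycle {c : (Fin 2 → ℕ) → ZMod 3} (hc : c ∈ cycle) {F : Finset (Fin 2)}
    (hF : F.Nonempty) : step 3 F (chart F) (tau c) c ∈ cycle := by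
  rcases finset_fin_two_cases F with rfl | rfl | rfl | rfl
  · exact absurd hF Finset.not_nonempty_empty
  · rw [chart_zero, step_singleton 0 _ c (clean_of_inCycle hc) (mF0_lt hc)]; exact hc
  · rw [chart_one, step_singleton 1 _ c (clean_of_inCycle hc) (mF1_lt hc)]; exact hc
  · rw [chart_pair]
    rcases (mem_cycle_iff c).mp hc with rfl | rfl | rfl | rfl | rfl | rfl
    · rw [tau_S0, step_S0]; exact (mem_cycle_iff _).mpr (by simp)
    · rw [tau_S1, step_S1]; exact (mem_cycle_iff _).mpr (by simp)
    · rw [tau_S2, step_S2]; exact (mem_cycle_iff _).mpr (by simp)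
    · rw [tau_S3, step_S3]; exact (mem_cycle_iff _).mpr (by simp)
    · rw [tau_S4, step_S4]; exact (mem_cycle_iff _).mpr (by simp)
    · rw [tau_S5, step_S5]; exact (mem_cycle_iff _).mpr (by simp)

/-- B's simulated play never leaves the cycle, against EVERY strategy with non-empty centres.
[folklore] -/
theorem run_fst_mem_cycle (strat : List (Set (Fin 2 → ℚ)) → List (Fin 2) → Finset (Fin 2))
    (hne : ∀ hs js, (strat hs js).Nonempty) : ∀ m, (run strat m).1 ∈ cycle
  | 0 => (mem_cycle_iff _).mpr (Or.inl rfl)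
  | m + 1 => by
    show step 3 (strat (run strat m).2.1 (run strat m).2.2)
        (chart (strat (run strat m).2.1 (run strat m).2.2)) (tau (run strat m).1) (run strat m).1 ∈ cycle
    exact step_mem_cycle (run_fst_mem_cycle strat hne m) (hne _ _)

/-- The actual play of the game from `S0` against B's sequences `iSeq / tSeq` IS B's simulation.
[folklore] -/
theorem play_eq_run (strat : List (Set (Fin 2 → ℚ)) → List (Fin 2) → Finset (Fin 2)) :
    ∀ m, play 3 strat S0 (iSeq strat) (tSeq strat) m = run strat m
  | 0 => rfl
  | m + 1 => by
    rw [play_succ, play_eq_run strat m]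
    rfl

end RevTwoTrap

section RevTwoTrapUse

open Summit.ResolutionOfSingularities.ResolutionOfSingularities.Theorems.ShadowGameWin.Negative

/-- **Any proof of `ShadowGameWinR` must use the formal clause**: without it B's period-6 trap in
`SG_3(2)` over `𝔽₃` from `v² + u³v + u³v²` (tree: `Theorems/ShadowGameWin/Negative/Trap.lean`,
`run_fst_mem_cycle'` / `not_terminal_of_inCycle`) beats every strategy. [folklore] -/
theorem shadowGameWinR_false_without_formalClause : ¬ ShadowGameWinRWithoutFormalClause := by
  intro hW
  obtain ⟨strat, hne, hwin⟩ := hW 3 (by norm_num) 2 (by norm_num)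
  haveI : PerfectField (ZMod 3) := PerfectField.ofFinite
  obtain ⟨m, hm⟩ := hwin (ZMod 3) S0 (iSeq strat) (tSeq strat)
    (fun m => by rw [play_eq_run strat m]; exact chart_mem (hne _ _))
  rw [play_eq_run strat m] at hm
  exact not_terminal_of_inCycle (run_fst_mem_cycle strat hne m) hm

end RevTwoTrapUse

/-! ## §3 Mirror of the repaired game -/

section MirrorR

variable {n : ℕ} {κ : Type} [Field κ] (p : ℕ)

/-- The NEW terminal clause (verbatim body): `clean c` is, coefficientwise, `w^A · v + g^p` for a
formal regular system of parameters `w`, an exponent `A ∉ pℕ^n`, a unit `v`. [folklore] -/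
def FormalMono (c : (Fin n → ℕ) → κ) : Prop :=
  ∃ (w : Fin n → MvPowerSeries (Fin n) κ) (A : Fin n → ℕ) (v g : MvPowerSeries (Fin n) κ),
    Ideal.span (Set.range w) = IsLocalRing.maximalIdeal (MvPowerSeries (Fin n) κ) ∧
    (∃ j, ¬ p ∣ A j) ∧ IsUnit v ∧
    ∀ B : Fin n →₀ ℕ, clean p c ⇑B =
      MvPowerSeries.coeff B (Finset.prod Finset.univ (fun j => w j ^ A j) * v + g ^ p)

/-- The rev-2 terminal test (clauses 1–2 of the repaired one). [folklore] -/
def TerminalOld (c : (Fin n → ℕ) → κ) : Prop :=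
  (∀ A, clean p c A = 0) ∨
    ∃ A, clean p c A ≠ 0 ∧
      (Finset.sum Finset.univ (fun j => A j) ≤ 1 ∨ ∀ B, clean p c B ≠ 0 → ∀ j, A j ≤ B j)

/-- The repaired terminal test TERMINAL′ (verbatim body of the route's `Terminal`). [folklore] -/
def TerminalR (c : (Fin n → ℕ) → κ) : Prop :=
  (∀ A, clean p c A = 0) ∨
    (∃ A, clean p c A ≠ 0 ∧
      (Finset.sum Finset.univ (fun j => A j) ≤ 1 ∨ ∀ B, clean p c B ≠ 0 → ∀ j, A j ≤ B j)) ∨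
    FormalMono p c

/-- The old test implies the new one. [folklore] -/
theorem terminalR_of_old {c : (Fin n → ℕ) → κ} (h : TerminalOld p c) : TerminalR p c := by
  rcases h with h | h
  · exact Or.inl h
  · exact Or.inr (Or.inl h)

end MirrorR

/-- `AWinsR p n`: the resolver A has a shadow-measurable winning strategy in the REPAIRED game
`SG^R_p(n)` — the inner statement of `ShadowGameWinR` at `(p, n)`. [folklore] -/
def AWinsR (p n : ℕ) : Prop :=
  ∃ strat : List (Set (Fin n → ℚ)) → List (Fin n) → Finset (Fin n),
    (∀ hs js, (strat hs js).Nonempty) ∧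
    ∀ (κ : Type) [Field κ] [CharP κ p] [PerfectField κ] (c₀ : (Fin n → ℕ) → κ) (i : ℕ → Fin n)
      (t : ℕ → Fin n → κ),
      (∀ m, i m ∈ strat (play p strat c₀ i t m).2.1 (play p strat c₀ i t m).2.2) →
        ∃ m, TerminalR p (play p strat c₀ i t m).1

/-- The route decl IS `∀ p prime, ∀ n ≥ 1, AWinsR p n`, definitionally (the mirror is verbatim).
[folklore] -/
theorem shadowGameWinR_iff_aWinsR :
    ShadowGameWinR ↔ ∀ p : ℕ, p.Prime → ∀ n : ℕ, 0 < n → AWinsR p n :=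
  Iff.rfl

/-- A rev-2 win is a rev-3 win (the whistle only got more permissive). [folklore] -/
theorem aWinsR_of_aWinsOld (p n : ℕ) (h : AWinsOld p n) : AWinsR p n := by
  obtain ⟨strat, hne, hwin⟩ := h
  refine ⟨strat, hne, fun κ _ _ _ c₀ i t hleg => ?_⟩
  obtain ⟨m, hm⟩ := hwin κ c₀ i t hleg
  exact ⟨m, terminalR_of_old p hm⟩

/-- `n = 1` is still an A-win at stage 0: a non-zero cleaned series in one variable has a least
exponent. [folklore] -/
theorem aWinsR_one (p : ℕ) : AWinsR p 1 := by
  refine aWinsR_of_aWinsOld p 1 ⟨fun _ _ => Finset.univ, fun _ _ => ⟨0, Finset.mem_univ _⟩, ?_⟩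
  intro κ _ _ _ c₀ i t _
  refine ⟨0, ?_⟩
  show (∀ A, clean p c₀ A = 0) ∨ ∃ A, clean p c₀ A ≠ 0 ∧
    (Finset.sum Finset.univ (fun j => A j) ≤ 1 ∨ ∀ B, clean p c₀ B ≠ 0 → ∀ j, A j ≤ B j)
  by_cases h0 : ∀ A, clean p c₀ A = 0
  · exact Or.inl h0
  · right
    push Not at h0
    have hfun : ∀ A : Fin 1 → ℕ, A = fun _ => A 0 := fun A =>
      funext fun j => by rw [Subsingleton.elim j 0]
    have hex : ∃ l : ℕ, clean p c₀ (fun _ => l) ≠ 0 := by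
      obtain ⟨A, hA⟩ := h0
      exact ⟨A 0, hfun A ▸ hA⟩
    classical
    refine ⟨fun _ => Nat.find hex, Nat.find_spec hex, Or.inr fun B hB j => ?_⟩
    have hB' : clean p c₀ (fun _ => B 0) ≠ 0 := hfun B ▸ hB
    rw [Subsingleton.elim j 0]
    exact Nat.find_min' hex hB'

/-- COSTUME probe for the hypothetical re-pointing at `n ≤ 1`: the antecedent restricted to one
variable is TRUE, so `(∀ p prime, AWinsR p 1) → TorsorLUPerfect` is the bare target. [folklore] -/
theorem repointed_at_one_iff :
    ((∀ p : ℕ, p.Prime → AWinsR p 1) → TorsorLUPerfect) ↔ TorsorLUPerfect :=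
  ⟨fun h => h fun p _ => aWinsR_one p, fun hT _ => hT⟩

/-! ## §4 Vacuity attack at `n = 3`: B's "hidden tangency" trap (NEAR-MISS in Lean) -/

section TrapR3

variable (p : ℕ) [Fact p.Prime]

/-- B's start in `SG^R_p(3)` over `𝔽_p` (p odd): the seven coefficients of
`a₀ = u₁² (u₁ + h²)^p = u₁^(p+2) + u₁² (u₃^p − u₂^p − u₂^p u₃^p)²`, `h = u₃ − u₂ − u₂ u₃`
(indices `0,1,2` = `u₁,u₂,u₃`). [folklore] -/
def startR3 : (Fin 3 → ℕ) → ZMod p := fun B =>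
  if B = ![p + 2, 0, 0] then 1 else
  if B = ![2, 0, 2 * p] then 1 else
  if B = ![2, 2 * p, 0] then 1 else
  if B = ![2, 2 * p, 2 * p] then 1 else
  if B = ![2, p, p] then -2 else
  if B = ![2, p, 2 * p] then -2 else
  if B = ![2, 2 * p, p] then 2 else 0

/-- B's chart: never `u₁`; `u₂` on `{u₁,u₂}`, on `{u₂,u₃}` and on the point; `u₃` on `{u₁,u₃}`;
forced on singletons. [folklore] -/
def chartR3 (F : Finset (Fin 3)) : Fin 3 :=
  if (1 : Fin 3) ∈ F ∧ F ≠ {1, 2} ∧ F ≠ ({0, 1, 2} : Finset (Fin 3)) ∧ F ≠ {0, 1} ∧ F ≠ {1} then 1 else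
  if F = {1, 2} ∨ F = ({0, 1, 2} : Finset (Fin 3)) ∨ F = {0, 1} ∨ F = {1} then 1 else
  if (2 : Fin 3) ∈ F then 2 else 0

/-- B's translation vector, CONSTANT: never move `u₁` or `u₂`, always `u₃ ↦ u₃ + 1` (only read
when `u₃ ∈ F ∖ {chart}`, i.e. on `{u₂,u₃}` and on the point, where it follows the invariant branch
`h = 0`: `h(u₂, u₂(u₃ + 1)) = u₂ · h`). [folklore] -/
def tauR3 : Fin 3 → ZMod p := ![0, 0, 1]

/-- B's simulation of the deterministic play against `strat` (state, shadow history, chart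
history), answering `chartR3` / `tauR3`. [folklore] -/
def runR3 (strat : List (Set (Fin 3 → ℚ)) → List (Fin 3) → Finset (Fin 3)) :
    ℕ → ((Fin 3 → ℕ) → ZMod p) × List (Set (Fin 3 → ℚ)) × List (Fin 3)
  | 0 => (startR3 p, [shadow p (startR3 p)], [])
  | m + 1 =>
    let st := runR3 strat m
    let F := strat st.2.1 st.2.2
    (step p F (chartR3 F) (tauR3 p) st.1,
      st.2.1 ++ [shadow p (step p F (chartR3 F) (tauR3 p) st.1)], st.2.2 ++ [chartR3 F])

/-- B's chart sequence read off the simulation. [folklore] -/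
def iSeqR3 (strat : List (Set (Fin 3 → ℚ)) → List (Fin 3) → Finset (Fin 3)) (m : ℕ) : Fin 3 :=
  chartR3 (strat (runR3 p strat m).2.1 (runR3 p strat m).2.2)

/-- B's chart is legal. [folklore] -/
theorem chartR3_mem : ∀ F : Finset (Fin 3), F.Nonempty → chartR3 F ∈ F := by decide

/-- The actual play from `startR3` against `iSeqR3 / tauR3` IS B's simulation. [folklore] -/
theorem play_eq_runR3 (strat : List (Set (Fin 3 → ℚ)) → List (Fin 3) → Finset (Fin 3)) :
    ∀ m, play p strat (startR3 p) (iSeqR3 p strat) (fun _ => tauR3 p) m = runR3 p strat m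
  | 0 => rfl
  | m + 1 => by
    rw [play_succ, play_eq_runR3 strat m]
    rfl

/-- **NEAR-MISS (the cycle-1 finding, certified by computation, NOT kernel-checked).**  Along B's
play no position is TERMINAL′.  Mathematical proof sketch: every `(runR3 p strat m).1` is
`clean (ε · u^M · q^p)` with `M 0 = 2` and `q` smooth with linear part `∝ u₁` or singular prime
(invariance of the family under all seven centres with B's answers: module docstring §4 and
`BWIN-n3.md` §2, cross-checked against the literal `step`); such positions are not `FormalMono` by
the D-lemma (gcd of partial derivatives), and clauses 1–2 fail by inspection of supports.
OBSTRUCTION (why `sorry`): clause 3 quantifies over `MvPowerSeries (Fin 3) κ`; its refutation needs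
derivations on multivariate power series and unique factorisation in `κ⟦u₁,u₂,u₃⟧`, neither in
Mathlib; tried: jet-level (degree ≤ 2) coefficient comparison — insufficient in principle, since
`a` agrees with the terminal monomial `ε ν^p u^(M + p e₁)` below degree `|M| + 2p`. [folklore] -/
theorem trapR3_nonterminal (hp : p ≠ 2)
    (strat : List (Set (Fin 3 → ℚ)) → List (Fin 3) → Finset (Fin 3))
    (hne : ∀ hs js, (strat hs js).Nonempty) :
    ∀ m, ¬ TerminalR p (runR3 p strat m).1 := by
  sorry

/-- CONDITIONAL (on `trapR3_nonterminal`): B wins `SG^R_p(3)` for every odd prime. [folklore] -/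
theorem not_aWinsR_three (hp : p ≠ 2) : ¬ AWinsR p 3 := by
  rintro ⟨strat, hne, hwin⟩
  haveI : PerfectField (ZMod p) := PerfectField.ofFinite
  obtain ⟨m, hm⟩ := hwin (ZMod p) (startR3 p) (iSeqR3 p strat) (fun _ => tauR3 p) (fun m => by
    rw [play_eq_runR3 p strat m]; exact chartR3_mem _ (hne _ _))
  rw [play_eq_runR3 p strat m] at hm
  exact trapR3_nonterminal p hp strat hne m hm

end TrapR3

/-- CONDITIONAL (on `trapR3_nonterminal` at `p = 3`): the antecedent of the crux is false.
[folklore] -/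
theorem not_shadowGameWinR : ¬ ShadowGameWinR := by
  intro hW
  haveI : Fact (Nat.Prime 3) := ⟨Nat.prime_three⟩
  exact not_aWinsR_three 3 (by decide) ((shadowGameWinR_iff_aWinsR.mp hW) 3 Nat.prime_three 3
    (by norm_num))

/-- CONDITIONAL VERDICT (on `trapR3_nonterminal`): the crux holds — vacuously; the candidate closing
proof for a prover is this one-liner once `¬ ShadowGameWinR` is in the tree. [folklore] -/
theorem winToTorsorLUR_of_trapR3 : WinToTorsorLUR :=
  winToTorsorLUR_of_not_shadowGameWinR not_shadowGameWinR

end Summit.ResolutionOfSingularities.ResolutionOfSingularities.Cruxes.WinToTorsorLUR.Disproof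

end
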